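import Literature.NumberTheory.DiophantineApproximation.RidoutClasses

/-!
# The `p`-adic Roth theorem over `ℚ` (Ridout) — rational approximations `β` with `|β| ≤ 1`

Bombieri–Gubler [BombieriGubler2006] Thm. 6.2.3 for `K = ℚ` with the archimedean place present,
archimedean target `α_∞ = 0`, approximations `β = ρ ∈ ℚ` with `|ρ| ≤ 1`, and a finite set of
primes `S` with targets `θ_p ∈ \overline{ℚ_p}` (roots of monic `Q_p ∈ ℤ[X]`): for every `κ > 2`
only finitely many rationals `ρ` with `|ρ| ≤ 1` satisfy
`|ρ| · Π_{p∈S} min(1, |ρ − θ_p|_p) ≤ den(ρ)^{−κ}` (Ridout 1958 [Ridout1958]).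
Here this is REDUCED to the class contradiction with a partial archimedean share (the hypothesis
`hClass`: no unlimited supply of `ρ` with `|ρ| ≤ c₀ den(ρ)^{−μ}`,
`min(1,|ρ − θ_p|_p) ≤ den(ρ)^{−ν_p}` when `μ + Σ_p ν_p ≥ 2 + ε/2`), which generalises the tree's
`Ridout.false_of_class` (the case `μ = 1`) and is proved elsewhere.

* `Ridout.abs_num_le_den_of_abs_le_one` — `|ρ| ≤ 1 → |num ρ| ≤ den ρ`.
* `Ridout.exists_den_gt_of_abs_le_one` — an infinite set of rationals in `[-1, 1]` has members of
  arbitrarily large denominator.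
* `Ridout.finite_of_abs_le_one_of_class` — the theorem. Proof: Mahler's approximation classes
  `Ridout.exists_class` (B–G 6.4.2) applied with the archimedean place adjoined as one more
  coordinate (labelled by an auxiliary prime `p_∞ ∉ S`, `x_{p_∞}(ρ) = |ρ|`,
  `x_p(ρ) = |ρ − θ_p|_p`), at the exponent `1 + κ/2 < κ`; the resulting infinite class is an
  unlimited supply for `hClass` with `μ = (1+κ/2) λ_{p_∞}`, `ν_p = (1+κ/2) λ_p`.

NOT here: the class contradiction itself, the integer-target / `padicNorm` corollaries, general
number fields or general archimedean targets, and anything effective.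

## References

* [BombieriGubler2006] E. Bombieri, W. Gubler, *Heights in Diophantine Geometry*, CUP 2006,
  Thm. 6.2.3 and 6.4.2.
* [Ridout1958] D. Ridout, *The `p`-adic generalization of the Thue–Siegel–Roth theorem*,
  Mathematika 5 (1958) 40–48.
-/

noncomputable section

open Finset Real
open scoped Polynomial

namespace Literature.NumberTheory.DiophantineApproximation

namespace Ridout

/-- A rational of absolute value at most one has `|num ρ| ≤ den ρ`. [folklore] -/
theorem abs_num_le_den_of_abs_le_one (ρ : ℚ) (h : |(ρ : ℝ)| ≤ 1) : |ρ.num| ≤ (ρ.den : ℤ) := by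
  have hd : (0 : ℝ) < ρ.den := by exact_mod_cast ρ.den_pos
  rw [Rat.cast_def, abs_div, Nat.abs_cast, div_le_one hd, ← Int.cast_abs] at h
  exact_mod_cast h

/-- An infinite set of rationals of absolute value at most one has members with arbitrarily large
denominator (there are only finitely many rationals with `|num| ≤ den ≤ N`). [folklore] -/
theorem exists_den_gt_of_abs_le_one {M : Set ℚ} (hM : M.Infinite)
    (hle : ∀ ρ ∈ M, |(ρ : ℝ)| ≤ 1) (N : ℕ) : ∃ ρ ∈ M, N < ρ.den := by
  by_contra hcon
  push Not at hcon
  apply hM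
  have hsub : M ⊆ (fun ρ : ℚ => (ρ.num, ρ.den)) ⁻¹'
      ((Finset.Icc (-(N : ℤ)) N ×ˢ Finset.Icc 0 N : Finset (ℤ × ℕ)) : Set (ℤ × ℕ)) := by
    intro ρ hρ
    have h2 := hcon ρ hρ
    have h1 : |ρ.num| ≤ (N : ℤ) :=
      (abs_num_le_den_of_abs_le_one ρ (hle ρ hρ)).trans (by exact_mod_cast h2)
    simp only [Set.mem_preimage, Finset.coe_product, Finset.coe_Icc, Set.mem_prod, Set.mem_Icc]
    exact ⟨⟨by linarith [neg_abs_le ρ.num], le_of_abs_le h1⟩, ⟨Nat.zero_le _, h2⟩⟩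
  refine Set.Finite.subset (Set.Finite.preimage ?_ (Finset.finite_toSet _)) hsub
  intro ρ _ ρ' _ h
  simp only [Prod.mk.injEq] at h
  exact Rat.ext h.1 h.2

/-- **Ridout's theorem over `ℚ` for approximations `ρ` with `|ρ| ≤ 1`, archimedean target `0`**
(Bombieri–Gubler Thm. 6.2.3 for `K = ℚ`, `∞ ∈ S`, `α_∞ = 0`, `|β| ≤ 1`), reduced to the class
contradiction `hClass` with a partial archimedean share: for a finite set of primes `S`,
`θ_p ∈ \overline{ℚ_p}` and `κ > 2`, only finitely many rationals `ρ` with `|ρ| ≤ 1` satisfy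
`|ρ| · Π_{p∈S} min(1, |ρ − θ_p|_p) ≤ den(ρ)^{−κ}`.
Proof: otherwise discard the finitely many `ρ` with `den ρ ≤ 1` or `ρ = θ_p` for some `p ∈ S`;
adjoin to `S` a label `p_∞ ∉ S` for the archimedean place with `x_{p_∞}(ρ) = |ρ|`, so that
`Π_{S ∪ {p_∞}} min(1, x_p(ρ)) ≤ den(ρ)^{−κ} < den(ρ)^{−(1+δ)}`, `δ = κ/2 > 1`; Mahler's classes
`Ridout.exists_class` with `N > 2(1+δ)(|S|+1)/(δ−1)` give `λ_p ≥ 0`,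
`(1+δ) Σ_{S ∪ {p_∞}} λ_p ≥ 2 + (δ−1)/2` and an infinite class, which (its members having `|ρ| ≤ 1`,
hence unbounded denominators) is an unlimited supply contradicting `hClass` with `c₀ = 1`,
`ε = δ − 1`, `μ = (1+δ)λ_{p_∞}`, `ν_p = (1+δ)λ_p`. The hypotheses `hQm`, `hQd`, `hθ` are not used
in this reduction (they are consumed by the class contradiction).
[cite: BombieriGubler2006, Thm. 6.2.3 with 6.4.2 (K = ℚ, α_∞ = 0); Ridout1958] -/
theorem finite_of_abs_le_one_of_class (S : Finset Nat.Primes) (Q : Nat.Primes → ℤ[X])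
    (_hQm : ∀ p ∈ S, (Q p).Monic) (_hQd : ∀ p ∈ S, 1 ≤ (Q p).natDegree)
    (θ : ∀ p : Nat.Primes, @PadicAlgCl (p : ℕ) ⟨p.2⟩)
    (_hθ : ∀ p ∈ S, Polynomial.aeval (θ p) (Q p) = 0) {κ : ℝ} (hκ : 2 < κ)
    (hClass : ∀ (c₀ : ℕ), 1 ≤ c₀ → ∀ (ε : ℝ), 0 < ε → ∀ (μ : ℝ), 0 ≤ μ →
      ∀ (ν : Nat.Primes → ℝ), (∀ p, 0 ≤ ν p) → 2 + ε / 2 ≤ μ + ∑ p ∈ S, ν p →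
      (∀ N : ℕ, ∃ ρ : ℚ, N < ρ.den ∧ (|(ρ : ℝ)| ≤ c₀ * (ρ.den : ℝ) ^ (-μ) ∧
        ∀ p ∈ S, min 1 ‖(ρ : @PadicAlgCl (p : ℕ) ⟨p.2⟩) - θ p‖ ≤ (ρ.den : ℝ) ^ (-(ν p)))) →
      False) :
    {ρ : ℚ | |(ρ : ℝ)| ≤ 1 ∧
      |(ρ : ℝ)| * (∏ p ∈ S, min (1 : ℝ) ‖(ρ : @PadicAlgCl (p : ℕ) ⟨p.2⟩) - θ p‖) ≤
        (ρ.den : ℝ) ^ (-κ)}.Finite := by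
  classical
  have _inst (p : Nat.Primes) : Fact (p : ℕ).Prime := ⟨p.2⟩
  by_contra hinf
  -- the exceptional points: `den ρ ≤ 1` (with `|ρ| ≤ 1`), or `ρ = θ_p` for some `p ∈ S`
  set Bad : Set ℚ := {ρ : ℚ | |(ρ : ℝ)| ≤ 1 ∧ ρ.den ≤ 1} ∪
    ⋃ p ∈ S, {ρ : ℚ | (ρ : PadicAlgCl (p : ℕ)) = θ p} with hBad
  have hBadfin : Bad.Finite := by
    refine Set.Finite.union ?_ (Set.Finite.biUnion S.finite_toSet fun p _ => ?_)
    · -- `|ρ| ≤ 1` and `den ρ ≤ 1`: finitely many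
      by_contra h
      obtain ⟨ρ, hρ, hden⟩ :=
        exists_den_gt_of_abs_le_one (M := {ρ : ℚ | |(ρ : ℝ)| ≤ 1 ∧ ρ.den ≤ 1}) h
          (fun ρ hρ => hρ.1) 1
      have := hρ.2
      omega
    · -- at most one rational equals `θ_p`
      refine Set.Subsingleton.finite ?_
      intro ρ hρ ρ' hρ'
      exact Rat.cast_injective (hρ.trans hρ'.symm)
  set M : Set ℚ := {ρ : ℚ | |(ρ : ℝ)| ≤ 1 ∧
      |(ρ : ℝ)| * (∏ p ∈ S, min (1 : ℝ) ‖(ρ : PadicAlgCl (p : ℕ)) - θ p‖) ≤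
        (ρ.den : ℝ) ^ (-κ)} \ Bad with hM
  have hMinf : M.Infinite := Set.Infinite.sdiff hinf hBadfin
  have hMle : ∀ ρ ∈ M, |(ρ : ℝ)| ≤ 1 := fun ρ hρ => hρ.1.1
  have hMden : ∀ ρ ∈ M, 2 ≤ ρ.den := by
    rintro ρ ⟨⟨hle, -⟩, hbad⟩
    by_contra hlt
    exact hbad (Or.inl ⟨hle, by omega⟩)
  have hMpos : ∀ ρ ∈ M, ∀ p ∈ S, 0 < ‖(ρ : PadicAlgCl (p : ℕ)) - θ p‖ := by
    rintro ρ ⟨-, hbad⟩ p hp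
    rw [norm_pos_iff, sub_ne_zero]
    intro h
    exact hbad (Or.inr (Set.mem_biUnion (Finset.mem_coe.mpr hp) h))
  have hMabs : ∀ ρ ∈ M, 0 < |(ρ : ℝ)| := by
    intro ρ hρ
    rw [abs_pos, ne_eq, Rat.cast_eq_zero]
    intro h0
    have h2 := hMden ρ hρ
    rw [h0] at h2
    simp at h2
  -- a label `p∞ ∉ S` for the archimedean place
  obtain ⟨pinf, hpinf⟩ : ∃ pinf : Nat.Primes, pinf ∉ S := by
    obtain ⟨q, hq, hqprime⟩ := Nat.exists_infinite_primes (S.sup (fun p => (p : ℕ)) + 1)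
    refine ⟨⟨q, hqprime⟩, fun h => ?_⟩
    have h1 : q ≤ S.sup (fun p : Nat.Primes => (p : ℕ)) :=
      Finset.le_sup (f := fun p : Nat.Primes => (p : ℕ)) h
    omega
  set S' : Finset Nat.Primes := insert pinf S with hS'
  have hS'card : S'.card = S.card + 1 := by rw [hS', Finset.card_insert_of_notMem hpinf]
  have hS'cardR : (S'.card : ℝ) = S.card + 1 := by exact_mod_cast hS'card
  -- the coordinates: `x_{p∞}(ρ) = |ρ|`, `x_p(ρ) = |ρ − θ_p|_p`
  set x : ℚ → Nat.Primes → ℝ := fun ρ p =>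
    if p = pinf then |(ρ : ℝ)| else ‖(ρ : PadicAlgCl (p : ℕ)) - θ p‖ with hx
  have hx_inf : ∀ ρ, x ρ pinf = |(ρ : ℝ)| := fun ρ => by simp [hx]
  have hx_S : ∀ ρ, ∀ p ∈ S, x ρ p = ‖(ρ : PadicAlgCl (p : ℕ)) - θ p‖ := fun ρ p hp => by
    have hne : p ≠ pinf := ne_of_mem_of_not_mem hp hpinf
    simp [hx, hne]
  have hpos : ∀ ρ ∈ M, ∀ p ∈ S', 0 < x ρ p := by
    intro ρ hρ p hp
    rw [hS', Finset.mem_insert] at hp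
    rcases hp with hp | hp
    · rw [hp, hx_inf]; exact hMabs ρ hρ
    · rw [hx_S ρ p hp]; exact hMpos ρ hρ p hp
  have hprod : ∀ ρ ∈ M, ∏ p ∈ S', min 1 (x ρ p) =
      |(ρ : ℝ)| * ∏ p ∈ S, min (1 : ℝ) ‖(ρ : PadicAlgCl (p : ℕ)) - θ p‖ := by
    intro ρ hρ
    rw [hS', Finset.prod_insert hpinf, hx_inf, min_eq_right (hMle ρ hρ)]
    congr 1
    exact Finset.prod_congr rfl fun p hp => by rw [hx_S ρ p hp]
  -- exponents: `δ = κ/2 > 1`, `1 + δ < κ`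
  set δ : ℝ := κ / 2 with hδ
  have hδ1 : 1 < δ := by rw [hδ]; linarith
  have hδpos : 0 < δ := by linarith
  have hδκ : 1 + δ < κ := by rw [hδ]; linarith
  have hsol : ∀ ρ ∈ M, ∏ p ∈ S', min 1 (x ρ p) < (ρ.den : ℝ) ^ (-(1 + δ)) := by
    intro ρ hρ
    rw [hprod ρ hρ]
    have hd1 : (1 : ℝ) < ρ.den := by exact_mod_cast lt_of_lt_of_le one_lt_two (hMden ρ hρ)
    exact lt_of_le_of_lt hρ.1.2 (Real.rpow_lt_rpow_of_exponent_lt hd1 (by linarith))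
  -- Mahler's classes with `N > 2(1+δ)(|S|+1)/(δ-1)`
  set N : ℕ := ⌈2 * (1 + δ) * (S.card + 1) / (δ - 1)⌉₊ + 1 with hN
  have hNpos : 0 < N := Nat.succ_pos _
  have hNR : 2 * (1 + δ) * (S.card + 1) / (δ - 1) ≤ N := by
    rw [hN]; push_cast; linarith [Nat.le_ceil (2 * (1 + δ) * (S.card + 1) / (δ - 1))]
  obtain ⟨lam, hlam0, hlamsum, hCinf⟩ :=
    exists_class S' x hδpos N hNpos M hMinf hMden hpos hsol
  -- the weights of the class contradiction: `μ = (1+δ) λ_{p∞}`, `ν_p = (1+δ) λ_p`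
  have hlam : 2 + (δ - 1) / 2 ≤ (1 + δ) * lam pinf + ∑ p ∈ S, (1 + δ) * lam p := by
    have hNR' : (0 : ℝ) < N := by exact_mod_cast hNpos
    rw [hS'cardR] at hlamsum
    have hsum' : ∑ p ∈ S', lam p = lam pinf + ∑ p ∈ S, lam p := by
      rw [hS', Finset.sum_insert hpinf]
    rw [← Finset.mul_sum, ← mul_add, ← hsum']
    have ht : (1 + δ) * (((S.card : ℝ) + 1) / N) ≤ (δ - 1) / 2 := by
      rw [← mul_div_assoc, div_le_iff₀ hNR']
      rw [div_le_iff₀ (by linarith : (0 : ℝ) < δ - 1)] at hNR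
      linarith
    have h2 : (1 + δ) * (1 - ((S.card : ℝ) + 1) / N) ≤ (1 + δ) * ∑ p ∈ S', lam p :=
      mul_le_mul_of_nonneg_left hlamsum (by linarith)
    linarith
  -- the supply from the infinite class
  have hsupply : ∀ N₀ : ℕ, ∃ ρ : ℚ, N₀ < ρ.den ∧
      (|(ρ : ℝ)| ≤ (1 : ℕ) * (ρ.den : ℝ) ^ (-((1 + δ) * lam pinf)) ∧
        ∀ p ∈ S, min 1 ‖(ρ : PadicAlgCl (p : ℕ)) - θ p‖ ≤
          (ρ.den : ℝ) ^ (-((1 + δ) * lam p))) := by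
    intro N₀
    obtain ⟨ρ, hρC, hden⟩ := exists_den_gt_of_abs_le_one hCinf (fun ρ hρ => hMle ρ hρ.1) N₀
    refine ⟨ρ, hden, ?_, fun p hp => ?_⟩
    · have h1 := hρC.2 pinf (by rw [hS']; exact Finset.mem_insert_self _ _)
      rw [hx_inf, min_eq_right (hMle ρ hρC.1)] at h1
      rw [Nat.cast_one, one_mul]
      exact h1
    · have h1 := hρC.2 p (by rw [hS']; exact Finset.mem_insert_of_mem hp)
      rwa [hx_S ρ p hp] at h1
  exact hClass 1 le_rfl (δ - 1) (by linarith) ((1 + δ) * lam pinf)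
    (mul_nonneg (by linarith) (hlam0 pinf)) (fun p => (1 + δ) * lam p)
    (fun p => mul_nonneg (by linarith) (hlam0 p)) hlam hsupply

end Ridout

end Literature.NumberTheory.DiophantineApproximation

end
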